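import Summits.CriticalPhenomena.PercolationContinuityZ3.Theses.PercNonProliferation

/-!
# Sketch — crux `SubpolynomialBlocking` (stmt-CriticalPhenomena-4446), ideator 1 (gen 2), round 1

Addendum to card `fkg-gate-calculus`: the DYADIC BK LADDER and the summability calibration.
Statements over existing declarations only (`box`, `innerBoundary`, `zdGraph`, `openConnIn`,
`bondPercolation`, `criticalProbI`, `theta`); `def … : Prop`, nothing proved except `Iff.rfl`.

* `DyadicBK`        — `P(B(n) ↔ ∂ⁱⁿB(2^k n) in B(2^k n)) ≤ ∏_{j<k} (1 - u(2^j n))`  (BK on the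
                       consecutive shells: the first-hit decomposition of ONE crossing path gives
                       edge-disjoint witnesses; `bk_finitary_list`).  Provable now.
* `NonSummableBlockingImpliesContinuity` — if `j ↦ u(2^j n)` is not summable for some `n ≥ 1`
                       then `θ(p_c) = 0` (from `DyadicBK`: `θ ≤ P(B(n) ↔ ∞) ≤ ∏ (1-u) = 0`).
                       Provable now.  Calibration: the crux (`u_n ≥ n^{-s}`) is on the SUMMABLE
                       side, `u_n ≥ c / log n` is not.
* `LogBlockingImpliesContinuity` — the weakest blocking statement I know that closes the
                       conjunct ALONE (no FreeBoxPowerSaving): `∃ c>0, ∀ᶠ n, c/log n ≤ u_n`.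
* `JumpForcesSummableBlocking` — conversely `θ(p_c) > 0 ⇒ ∑_j u(2^j n) ≤ -log P(B(n) ↔ ∞) < ∞`.
-/

noncomputable section

namespace Summit.CriticalPhenomena.PercolationContinuityZ3.Cruxes.SubpolynomialBlocking.SketchG2

open MeasureTheory Filter
open Literature.Probability.LatticeModels Literature.Probability.Percolation
open Summit.CriticalPhenomena.PercolationContinuityZ3.Theses.PercNonProliferation

/-- The critical bond measure on `ℤ³`. -/
def μc : Measure (BondConfig (Site 3)) := bondPercolation (zdGraph 3) (criticalProbI 3)

/-- Annulus blocking `Block(m, M)`: no open path inside `B(M)` from `B(m)` to `∂ⁱⁿB(M)`. -/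
def blockAnn (m M : ℕ) : Set (BondConfig (Site 3)) :=
  {ω | ¬ ∃ x ∈ box 3 m, ∃ y ∈ innerBoundary (zdGraph 3) (box 3 M),
      ω ∈ openConnIn (↑(box 3 M) : Set (Site 3)) x y}

/-- Annulus crossing `Cross(m, M)` (the complement of `blockAnn m M`). -/
def crossAnn (m M : ℕ) : Set (BondConfig (Site 3)) :=
  {ω | ∃ x ∈ box 3 m, ∃ y ∈ innerBoundary (zdGraph 3) (box 3 M),
      ω ∈ openConnIn (↑(box 3 M) : Set (Site 3)) x y}

/-- `u(m) := P_{p_c}(Block(m, 2m))`, the crux's blocking probability. -/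
def u (m : ℕ) : ℝ := μc.real (blockAnn m (2 * m))

/-- The crux, restated through `u` (definitionally the route decl). -/
theorem crux_iff :
    SubpolynomialBlocking ↔ ∀ s : ℝ, 0 < s → ∀ᶠ n : ℕ in atTop, (n : ℝ) ^ (-s) ≤ u n :=
  Iff.rfl

/-- FIRST LEMMA (provable now): the dyadic BK ladder. A path from `B(n)` to `∂ⁱⁿB(2^k n)` inside
`B(2^k n)`, cut at its first visits to `∂ⁱⁿB(2n), ∂ⁱⁿB(4n), …`, gives edge-disjoint witnesses of
the `k` consecutive shell crossings `Cross(2^j n, 2^{j+1} n)`; van den Berg–Kesten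
(`Literature.Probability.Percolation.bk_finitary_list`) turns this into a product bound. -/
def DyadicBK : Prop :=
  ∀ n k : ℕ, 1 ≤ n →
    μc.real (crossAnn n (2 ^ k * n)) ≤ ∏ j ∈ Finset.range k, (1 - u (2 ^ j * n))

/-- CALIBRATION (provable now from `DyadicBK` and `θ(p_c) ≤ P(B(n) ↔ ∞) ≤ P(Cross(n, 2^k n))`
for every `k`): a NON-SUMMABLE dyadic blocking sequence forces `θ(p_c) = 0`. The crux's
`n^{-s}` is summable along `2^j`, which is exactly why it does not decide `θ(p_c)`
(Disproof.lean §5); `c / log n` is not summable. -/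
def NonSummableBlockingImpliesContinuity : Prop :=
  (∃ n : ℕ, 1 ≤ n ∧ ¬ Summable fun j : ℕ => u (2 ^ j * n)) → _root_.PercolationContinuityZ3

/-- The weakest blocking-type statement known to me that closes the conjunct by itself
(strictly between the crux and `PercAnnulusCrossing.CritAnnulusNonCrossing`). -/
def LogBlocking : Prop :=
  ∃ c : ℝ, 0 < c ∧ ∀ᶠ n : ℕ in atTop, c / Real.log n ≤ u n

/-- `LogBlocking ⇒ θ(p_c) = 0` (provable now from `NonSummableBlockingImpliesContinuity`:
`∑_j c / log (2^j) = ∞`). -/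
def LogBlockingImpliesContinuity : Prop := LogBlocking → _root_.PercolationContinuityZ3

/-- Conversely, in the jump world blocking is summable along every dyadic sequence, with the
tail bound `∑_{j} u(2^j n) ≤ -log P_{p_c}(B(n) ↔ ∞) → 0` (provable now from `DyadicBK` and
`1 - x ≤ exp (-x)`). -/
def JumpForcesSummableBlocking : Prop :=
  0 < theta (zdGraph 3) (0 : Site 3) (criticalProbI 3) →
    ∀ n : ℕ, 1 ≤ n → Summable fun j : ℕ => u (2 ^ j * n)

end Summit.CriticalPhenomena.PercolationContinuityZ3.Cruxes.SubpolynomialBlocking.SketchG2
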